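import Summits.FinalStateConjecture.FinalStateConjecture.Theorems.EIHFluxBalanceInertialRecessionVirialTwoBody

/-!
# Route EIHFluxBalance — crux `InertialRecession`, abstract endgame for general `N`:
# the velocity increment of one body along a general window path (toward LEMMA SPLIT, visits, block L3)

Helper file for the crux `stmt-FinalStateConjecture-10166` (virial route, `work/split/PLAN.md`, N = 3 doubly-bad case).
Mathlib-only. `velocity_increment_of_windowPath`: the general-radius form of `velocity_frozen_of_isolated` — along a
2-Lipschitz positive radius function `R` on `[t₁, t₂]` with `ρ ≤ R/2`, the window `(ξₓ, R)` inside the cone and every other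
body beyond `3R/2`, the velocity of `x` changes by at most `6(C∫R^{-3/2} + ζ(t₁) + ζ(t₂))/Mₓ`
(`Oracle.increment_of_windowPath` + `abs_div_sub_div_le`). During a fly-by one takes `R(s) = d(s)/3`.
-/

noncomputable section

open Finset Filter Topology MeasureTheory intervalIntegral

namespace Summit.FinalStateConjecture.FinalStateConjecture.Theorems.SublinearIsFree.Virial

open Literature.Geometry.Lorentzian

variable {N : ℕ}

/-- **Velocity increment of one body along a general window path** (see the module docstring). [folklore] -/
theorem velocity_increment_of_windowPath (M : Fin N → ℝ) (ξ v : Fin N → ℝ → E3) (κ : ℝ) (P : ℝ → E3 → ℝ → Fin 4 → ℝ)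
    (ρ : ℝ → ℝ) (C T T' T₀ : ℝ) (ζ : ℝ → ℝ)
    (hWL : ∀ (t₁ t₂ : ℝ) (c : ℝ → E3) (R : ℝ → ℝ), T ≤ t₁ → t₁ ≤ t₂ →
      (∀ s ∈ Set.Icc t₁ t₂, ∀ s' ∈ Set.Icc t₁ t₂, ‖c s - c s'‖ ≤ 2 * |s - s'| ∧ |R s - R s'| ≤ 2 * |s - s'|) →
      (∀ s ∈ Set.Icc t₁ t₂, ρ s ≤ (1 / 2) * R s ∧ ‖c s‖ + R s ≤ (κ + κ ^ 2) / 2 * s ∧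
        ∀ j, ‖ξ j s - c s‖ ≤ (1 - 1 / 2) * R s ∨ (1 + 1 / 2) * R s ≤ ‖ξ j s - c s‖) →
      ∀ μ : Fin 4, |P t₂ (c t₂) (R t₂) μ - P t₁ (c t₁) (R t₁) μ| ≤ C * ∫ s in t₁..t₂, (R s ^ (3 / 2 : ℝ))⁻¹)
    (hID : ∀ (t : ℝ) (c : E3) (R : ℝ) (A : Finset (Fin N)), T' ≤ t → ρ t ≤ (1 / 2) * R →
      ‖c‖ + R ≤ (κ + κ ^ 2) / 2 * t →
      (∀ j, ‖ξ j t - c‖ ≤ (1 - 1 / 2) * R ∨ (1 + 1 / 2) * R ≤ ‖ξ j t - c‖) →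
      (∀ j, j ∈ A ↔ ‖ξ j t - c‖ ≤ (1 - 1 / 2) * R) →
      |P t c R 0 - ∑ j ∈ A, M j * (√(1 - ‖v j t‖ ^ 2))⁻¹| ≤ ζ t ∧
      ∀ k : Fin 3, |P t c R k.succ - ∑ j ∈ A, M j * (√(1 - ‖v j t‖ ^ 2))⁻¹ * v j t k| ≤ ζ t)
    (hdiff : ∀ i, Differentiable ℝ (ξ i)) (hspeed : ∀ i s, T₀ ≤ s → ‖deriv (ξ i) s‖ ≤ 2)
    {x : Fin N} (hM : 0 < M x) (hv1 : ∀ t, ‖v x t‖ < 1)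
    {t₁ t₂ : ℝ} {R : ℝ → ℝ} (hT : T ≤ t₁) (hT' : T' ≤ t₁) (hT₀ : T₀ ≤ t₁) (h12 : t₁ ≤ t₂)
    (hRlip : ∀ s ∈ Set.Icc t₁ t₂, ∀ s' ∈ Set.Icc t₁ t₂, |R s - R s'| ≤ 2 * |s - s'|)
    (hRpos : ∀ s ∈ Set.Icc t₁ t₂, 0 < R s) (hρ : ∀ s ∈ Set.Icc t₁ t₂, ρ s ≤ R s / 2)
    (hcap : ∀ s ∈ Set.Icc t₁ t₂, ‖ξ x s‖ + R s ≤ (κ + κ ^ 2) / 2 * s)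
    (hnon : ∀ s ∈ Set.Icc t₁ t₂, ∀ j, j ≠ x → 3 * R s / 2 ≤ ‖ξ j s - ξ x s‖) :
    ‖v x t₂ - v x t₁‖ ≤ 6 * (C * (∫ s in t₁..t₂, (R s ^ (3 / 2 : ℝ))⁻¹) + ζ t₁ + ζ t₂) / M x := by
  classical
  have hinc := Oracle.increment_of_windowPath M ξ v κ P ρ C T T' T₀ ζ hWL hID hdiff hspeed (A := {x}) (a := x)
    (t₁ := t₁) (t₂ := t₂) (R := R) hT hT' hT₀ h12 hRlip hRpos hρ hcap
    (fun s hs i hi ↦ by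
      rw [Finset.mem_singleton.mp hi, sub_self, norm_zero]
      exact (half_pos (hRpos s hs)).le)
    (fun s hs j hj ↦ hnon s hs j fun h ↦ hj (Finset.mem_singleton.mpr h))
  simp only [Finset.sum_singleton] at hinc
  set Bd : ℝ := C * (∫ s in t₁..t₂, (R s ^ (3 / 2 : ℝ))⁻¹) + ζ t₁ + ζ t₂ with hBd
  have hE : |M x * (√(1 - ‖v x t₂‖ ^ 2))⁻¹ - M x * (√(1 - ‖v x t₁‖ ^ 2))⁻¹| ≤ Bd := hinc.1
  have hP : ∀ k : Fin 3, |M x * (√(1 - ‖v x t₂‖ ^ 2))⁻¹ * v x t₂ k - M x * (√(1 - ‖v x t₁‖ ^ 2))⁻¹ * v x t₁ k| ≤ Bd :=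
    hinc.2
  -- energies are at least `M x`
  have hγ : ∀ t, 1 ≤ (√(1 - ‖v x t‖ ^ 2))⁻¹ := fun t ↦ Endgame.one_le_inv_sqrt_one_sub_sq (hv1 t)
  have hEge : ∀ t, M x ≤ M x * (√(1 - ‖v x t‖ ^ 2))⁻¹ := fun t ↦ le_mul_of_one_le_right hM.le (hγ t)
  have hEpos : ∀ t, 0 < M x * (√(1 - ‖v x t‖ ^ 2))⁻¹ := fun t ↦ hM.trans_le (hEge t)
  -- componentwise velocity change
  have hcomp : ∀ k : Fin 3, |v x t₂ k - v x t₁ k| ≤ 2 * Bd / M x := by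
    intro k
    have hvk : ∀ t, |v x t k| ≤ 1 := fun t ↦ by
      have h1 : ‖v x t k‖ ≤ ‖v x t‖ := PiLp.norm_apply_le (v x t) k
      rw [Real.norm_eq_abs] at h1
      exact h1.trans (hv1 t).le
    have hp₁ : |M x * (√(1 - ‖v x t₁‖ ^ 2))⁻¹ * v x t₁ k| ≤ M x * (√(1 - ‖v x t₁‖ ^ 2))⁻¹ := by
      rw [abs_mul, abs_of_pos (hEpos t₁)]
      exact mul_le_of_le_one_right (hEpos t₁).le (hvk t₁)
    have h := abs_div_sub_div_le (p₁ := M x * (√(1 - ‖v x t₁‖ ^ 2))⁻¹ * v x t₁ k)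
      (p₂ := M x * (√(1 - ‖v x t₂‖ ^ 2))⁻¹ * v x t₂ k) hM (hEge t₁) (hEge t₂) hp₁
    rw [mul_div_cancel_left₀ _ (hEpos t₂).ne', mul_div_cancel_left₀ _ (hEpos t₁).ne'] at h
    refine h.trans ?_
    rw [div_le_div_iff_of_pos_right hM]
    linarith [hP k, hE]
  calc ‖v x t₂ - v x t₁‖ ≤ ∑ k, |(v x t₂ - v x t₁) k| := Endgame.norm_le_sum_abs _
    _ ≤ ∑ _k : Fin 3, 2 * Bd / M x := Finset.sum_le_sum fun k _ ↦ by
        rw [PiLp.sub_apply]; exact hcomp k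
    _ = 6 * Bd / M x := by simp; ring

/-- Registered one-line helper of this file: the singleton window membership is trivial. [folklore] -/
theorem norm_sub_self_le_half : open Literature.Geometry.Lorentzian in ∀ (y : E3) {R : ℝ}, 0 < R → ‖y - y‖ ≤ R / 2 :=
  fun y _ hR ↦ by rw [sub_self, norm_zero]; exact (half_pos hR).le

end Summit.FinalStateConjecture.FinalStateConjecture.Theorems.SublinearIsFree.Virial

end
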